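import Summits.QuantumFields.YangMills.Theses.FluxSectorAlternative
import Summits.QuantumFields.YangMills.Theorems.IR.TensionRatioFluxTYObservable
import Literature.MathematicalPhysics.QuantumLattice.LatticeGaugeDLRLimitPointsProofs
import Literature.MathematicalPhysics.QuantumLattice.WilsonLoopsProofs
import Literature.MathematicalPhysics.QuantumLattice.TwistEaterIrreducibility
import HarnessLib

/-!
# `FluxSectorAlternative.VortexAreaLawDeniesPerimeter` (support item ⟨stmt-QuantumFields-23871⟩, rank 9) — PROVED
# (routes `FluxSectorAlternative` = LINE g20-A and `VortexVolumeRatchet` = LINE g20-B of planner ym-idea-4 g20; prover ym-dw-p1 g20)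

The item: for `N ≥ 2`, a lattice representation `r` of `SU(N)` and `β > 0`, IF for every non-trivial centre element `z` and every
plane `q` of the four-torus the single-plane vortex ratio obeys the AREA-RATE light-flux bound
`1 − Z_z(L)/Z_1(L) ≤ C' L² e^{−σL²}` (`σ > 0`, all `L ≥ 2`), THEN not every infinite-volume limit point of the torus Wilson states of
`r` has the fundamental perimeter law.

Proof (Tomboulis–Yaffe, two representations, plus limit bookkeeping — exactly the plan recorded in the route file):
* §1 a limit state ALONG A PRESCRIBED SEQUENCE of torus sizes (here the dyadic sides `2^{k+1}`): the tree's compactness argument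
  `infiniteVolumeLimitPoints_nonempty_holds` run on a subsequence (`exists_isInfiniteVolumeLimitAlong_comp`);
* §2 the torus → limit-state dictionary for rectangular loops traced in a SECOND representation `π` under the `ρ`-state
  (`tendsto_wilsonExpectation_wilsonLoopRep`, twin of the tree's `tendsto_wilsonExpectation_wilsonLoop`);
* §3 the two-representation Tomboulis–Yaffe inequality of the tree (`Cruxes.IR.TensionRatio.FluxTY.wilsonLoopRep_abs_le_twist`,
  Theorems/IR/TensionRatioFluxTYObservable.lean; E. T. Tomboulis, L. G. Yaffe, Comm. Math. Phys. 100 (1985) 313, App. I) with the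
  loop in the FUNDAMENTAL representation (centre element `ω·1`, `ω = e^{2πi/N} ≠ 1` for `N ≥ 2`) and the action `r.ρ`, fed with the
  area-rate hypothesis: on the torus of side `L = 2^{k+1} ≥ L₀`, `|⟨W^f_{h×h}⟩| ≤ N · e^{−σh²/2}` for every dyadic `h ≤ L/2`
  (`abs_wilsonLoop_le_of_areaRate`);
* §4 the limit state along dyadic sides inherits `W(h,h) ≤ N e^{−σh²/2}`, incompatible with a perimeter floor `e^{−4ch}` for `h`
  large (`vortexAreaLawDeniesPerimeter_proof`).
HONEST FRAMING: a support item (finite-torus reflection positivity + soft compactness); its HYPOTHESIS (area-rate light centre flux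
at the given `β`) is what the cruxes of the two draft routes must supply and is NOT proved here; nothing here proves the leaf
`DeconfinedIsMassless`, `NoHiggsMode`, `DyadicVolumeRatchet`, any summit statement, or the Yang–Mills mass gap.
THEOREMS ONLY (no `def`, no `sorry`), standard axioms.
-/

set_option autoImplicit false

noncomputable section

open MeasureTheory Filter Topology
open Literature.MathematicalPhysics.QuantumFieldTheory
open Literature.MathematicalPhysics.QuantumLattice (LGConfig IsInfiniteVolumeLimitAlong infiniteVolumeLimitPoints
  toTorusObservable rectExpectation HasPerimeterLaw normalisedCharacter fundamentalRep wilsonLoopObs rectWalk suCenter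
  centerPhase)

namespace Summit.QuantumFields.YangMills.Theorems.FluxSectorAlternative

/-! ## §1 Limit states along a prescribed sequence of torus sizes -/

section LimitAlong

variable {d N : ℕ} {G : Type*} [Group G] [TopologicalSpace G] [IsTopologicalGroup G] [CompactSpace G]
  [MeasurableSpace G] [BorelSpace G] (ρ : G →* Matrix (Fin N) (Fin N) ℂ)

/-- **Subsequential infinite-volume limits along any prescribed sequence of torus sizes.** For a continuous representation
`ρ` of a compact second-countable Hausdorff group, every `β` and every sequence of torus sizes `Ls k + 1`, some subsequence
`Ls ∘ φ` of the torus Wilson states converges (on bounded continuous cylinder observables) to a probability measure `μ`: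
`IsInfiniteVolumeLimitAlong ρ β (Ls ∘ φ) μ` (the compactness argument of the tree's `infiniteVolumeLimitPoints_nonempty_holds`
— Prokhorov / Riesz–Markov on the compact metrizable `G^{edges(ℤ^d)}` — run on the subsequence). -/
theorem exists_isInfiniteVolumeLimitAlong_comp [T2Space G] [SecondCountableTopology G] (hρ : Continuous ρ) (β : ℝ)
    (Ls : ℕ → ℕ) :
    ∃ (μ : Measure (LGConfig d G)) (φ : ℕ → ℕ), StrictMono φ ∧ IsInfiniteVolumeLimitAlong ρ β (Ls ∘ φ) μ := by
  haveI := fun L : ℕ => isProbabilityMeasure_torusState (d := d) (L := L + 1) ρ hρ β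
  let P : ℕ → ProbabilityMeasure (LGConfig d G) := fun k => ⟨torusState ρ β (Ls k + 1), inferInstance⟩
  obtain ⟨μ, -, φ, hφ, hlim⟩ :=
    (isCompact_univ (X := ProbabilityMeasure (LGConfig d G))).tendsto_subseq fun n => Set.mem_univ (P n)
  refine ⟨(μ : Measure (LGConfig d G)), φ, hφ, inferInstance, fun F S _ hFc hFb => ?_⟩
  obtain ⟨C, hC⟩ := hFb
  let Fb : BoundedContinuousFunction (LGConfig d G) ℝ :=
    BoundedContinuousFunction.ofNormedAddCommGroup F hFc C (fun U => by simpa [Real.norm_eq_abs] using hC U)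
  have hE : (fun k : ℕ => wilsonExpectation (L := (Ls ∘ φ) k + 1) ρ β (toTorusObservable ((Ls ∘ φ) k + 1) F)) =
      fun k => ∫ U, Fb U ∂(P (φ k) : Measure (LGConfig d G)) :=
    funext fun k => wilsonExpectation_toTorusObservable ρ β (Ls (φ k) + 1) hFc.measurable
  have key : Tendsto (fun k : ℕ => ∫ U, Fb U ∂(P (φ k) : Measure (LGConfig d G))) atTop
      (𝓝 (∫ U, Fb U ∂(μ : Measure (LGConfig d G)))) :=
    (ProbabilityMeasure.tendsto_iff_forall_integral_tendsto.1 hlim) Fb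
  rw [hE]
  exact key

end LimitAlong

/-! ## §2 Rectangular loops in a second representation: torus expectations → limit state -/

section TwoRepLimit

variable {d N M : ℕ} {G : Type*} [Group G] [TopologicalSpace G] [IsTopologicalGroup G] [CompactSpace G]
  [MeasurableSpace G] [BorelSpace G] (ρ : G →* Matrix (Fin N) (Fin N) ℂ) (π : G →* Matrix (Fin M) (Fin M) ℂ)

/-- The rectangular `π`-loop expectation of a limit state of the `ρ`-action is the limit of the torus `π`-loop expectations
along the defining subsequence of tori (twin of the tree's `tendsto_wilsonExpectation_wilsonLoop`, which has `π = ρ`; the state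
only enters through `IsInfiniteVolumeLimitAlong`, the loop's representation only through the observable). -/
theorem tendsto_wilsonExpectation_wilsonLoopRep [NeZero d] (hπ : Continuous π) {β : ℝ} {μ : Measure (LGConfig d G)}
    {Ls : ℕ → ℕ} (hμ : IsInfiniteVolumeLimitAlong ρ β Ls μ) (R T : ℕ) :
    Tendsto (fun k : ℕ => wilsonExpectation (L := Ls k + 1) ρ β (wilsonLoop π (0 : Site d (Ls k + 1)) 0 1 R T))
      atTop (𝓝 (rectExpectation μ (fun g => normalisedCharacter M (π g)) 0 1 R T)) := by
  have hχ := Literature.MathematicalPhysics.QuantumLattice.continuous_normalisedCharacter_comp (N := M) hπ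
  have h := hμ.2 (wilsonLoopObs (fun g => normalisedCharacter M (π g))
      (rectWalk (0 : Literature.Probability.LatticeModels.Site d) 0 1 R T)) _
    (Literature.MathematicalPhysics.QuantumLattice.isCylinder_wilsonLoopObs _ _)
    (Literature.MathematicalPhysics.QuantumLattice.continuous_wilsonLoopObs hχ _)
    (Literature.MathematicalPhysics.QuantumLattice.exists_abs_wilsonLoopObs_le hχ _)
  have h0 : ∀ L : ℕ, Literature.Probability.LatticeModels.Torus.proj L (0 : Literature.Probability.LatticeModels.Site d) = 0 :=
    fun L => by funext i; simp [Literature.Probability.LatticeModels.Torus.proj]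
  simp only [Literature.MathematicalPhysics.QuantumLattice.toTorusObservable_wilsonLoopObs_rectWalk, h0] at h
  exact h

end TwoRepLimit

/-! ## §3 The fundamental loop under the area-rate light-flux hypothesis (Tomboulis–Yaffe, two representations) -/

section SUN

open Summit.QuantumFields.YangMills.Cruxes.IR.TensionRatio.FluxTY (wilsonLoopRep_abs_le_twist)

variable {N : ℕ}

/-- The fundamental representation sees the centre element `ω·1` (`ω = e^{2πi/N}`) as the scalar `ω`. -/
theorem fundamentalRep_suCenter_one (N : ℕ) :
    fundamentalRep (Fin N) (suCenter N 1 : Matrix.specialUnitaryGroup (Fin N) ℂ) =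
      centerPhase N 1 • (1 : Matrix (Fin N) (Fin N) ℂ) := rfl

/-- For `N ≥ 2` the phase `ω = e^{2πi/N}` is not `1`. -/
theorem centerPhase_one_ne_one (hN : 2 ≤ N) : centerPhase N 1 ≠ 1 := by
  haveI : NeZero N := ⟨by omega⟩
  exact (Literature.MathematicalPhysics.QuantumLattice.isPrimitiveRoot_centerPhase N isUnit_one).ne_one hN

/-- **The fundamental Wilson loop under an area-rate light centre flux** (Tomboulis–Yaffe fed with the hypothesis of the item).
`SU(N)`, `N ≥ 2`, action `r.ρ`, any real `β`; if for the centre element `ω·1` and the plane `(0,1)` the vortex ratio obeys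
`1 − Z_z(L)/Z_1(L) ≤ C' L² e^{−σL²}` for all `L ≥ 2` (`σ > 0`), then there is `L₀` such that on every dyadic torus of side
`L = 2^{k+1} ≥ L₀` and for every dyadic `h = 2^a ≤ L/2` with `2h ≤ L`... precisely for `a ≤ k` and `2 · 2^a ≤ 2^{k+1}`:
`|⟨W^{fund}_{h×h}⟩_{L, β}| ≤ N · e^{−σ h²/2}`. -/
theorem abs_wilsonLoop_le_of_areaRate (hN : 2 ≤ N)
    (r : LatticeRep (Matrix.specialUnitaryGroup (Fin N) ℂ)) (β : ℝ) {σ C' : ℝ} (hσ : 0 < σ)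
    (hbound : ∀ (L : ℕ) [NeZero L], 2 ≤ L →
      1 - twistedPartitionFunction (d := 4) r.ρ β L (suCenter N 1 : Matrix.specialUnitaryGroup (Fin N) ℂ) ⟨(0, 1), Fin.zero_lt_one⟩ /
          twistedPartitionFunction (d := 4) r.ρ β L 1 ⟨(0, 1), Fin.zero_lt_one⟩ ≤
        C' * (L : ℝ) ^ 2 * Real.exp (-(σ * (L : ℝ) ^ 2))) :
    ∃ L₀ : ℕ, ∀ (k a : ℕ) (L : ℕ) [NeZero L], L = 2 ^ (k + 1) → L₀ ≤ L → a ≤ k →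
      |wilsonExpectation (L := L) r.ρ β (wilsonLoop (fundamentalRep (Fin N)) (0 : Site 4 L) 0 1 (2 ^ a) (2 ^ a))| ≤
        (N : ℝ) * Real.exp (-(σ * ((2 ^ a : ℕ) : ℝ) ^ 2 / 2)) := by
  haveI : NeZero N := ⟨by omega⟩
  set z : Matrix.specialUnitaryGroup (Fin N) ℂ := (suCenter N 1 : Matrix.specialUnitaryGroup (Fin N) ℂ) with hz_def
  have hz : z ∈ Subgroup.center (Matrix.specialUnitaryGroup (Fin N) ℂ) := (suCenter N 1).2
  set ω : ℂ := centerPhase N 1 with hω_def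
  have hω : fundamentalRep (Fin N) z = ω • (1 : Matrix (Fin N) (Fin N) ℂ) := fundamentalRep_suCenter_one N
  have hω1 : ‖ω‖ = 1 := Literature.MathematicalPhysics.QuantumLattice.norm_centerPhase N 1
  have hne : ω ≠ 1 := centerPhase_one_ne_one hN
  have hω2 : 0 < ‖1 - ω‖ ^ 2 := by
    have : (1 : ℂ) - ω ≠ 0 := sub_ne_zero.2 (Ne.symm hne)
    positivity
  -- the constant `A = 8 C'' / |1 - ω|²`, `C'' = max C' 0`
  set A : ℝ := 8 * max C' 0 / ‖1 - ω‖ ^ 2 with hA_def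
  have hA0 : 0 ≤ A := div_nonneg (mul_nonneg (by norm_num) (le_max_right _ _)) hω2.le
  -- `L₀`: `A L² ≤ e^{σL²/2}` as soon as `L² ≥ 16 A / σ²`
  obtain ⟨L₀, hL₀⟩ : ∃ L₀ : ℕ, ∀ L : ℕ, L₀ ≤ L → A * (L : ℝ) ^ 2 ≤ Real.exp (σ * (L : ℝ) ^ 2 / 2) ∧ 2 ≤ L := by
    obtain ⟨n₀, hn₀⟩ := exists_nat_ge (16 * A / σ ^ 2)
    refine ⟨max n₀ 2, fun L hL => ⟨?_, le_of_max_le_right hL⟩⟩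
    have hL1 : (n₀ : ℝ) ≤ L := by exact_mod_cast le_of_max_le_left hL
    have hL2 : (1 : ℝ) ≤ L := by
      have : (2 : ℝ) ≤ L := by exact_mod_cast le_of_max_le_right hL
      linarith
    have hLsq : (16 * A / σ ^ 2) ≤ (L : ℝ) ^ 2 := by
      calc 16 * A / σ ^ 2 ≤ (n₀ : ℝ) := hn₀
        _ ≤ L := hL1
        _ ≤ (L : ℝ) ^ 2 := by nlinarith
    have hy : 0 ≤ σ * (L : ℝ) ^ 2 / 2 := by positivity
    have hexp : (σ * (L : ℝ) ^ 2 / 2) ^ 2 / 4 ≤ Real.exp (σ * (L : ℝ) ^ 2 / 2) := by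
      -- `e^{y} ≥ y²/4` for `y ≥ 0`, from `1 + y/2 ≤ e^{y/2}`
      set y : ℝ := σ * (L : ℝ) ^ 2 / 2 with hy_def
      have h1 : y / 2 + 1 ≤ Real.exp (y / 2) := Real.add_one_le_exp _
      have h2 : 0 ≤ y / 2 + 1 := by linarith
      have h3 : (y / 2 + 1) ^ 2 ≤ Real.exp (y / 2) ^ 2 := pow_le_pow_left₀ h2 h1 2
      rw [← Real.exp_nat_mul] at h3
      have h4 : ((2 : ℕ) : ℝ) * (y / 2) = y := by push_cast; ring
      rw [h4] at h3
      nlinarith [h3]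
    have h16 : 16 * A ≤ σ ^ 2 * (L : ℝ) ^ 2 := by
      rw [div_le_iff₀ (by positivity)] at hLsq
      linarith
    calc A * (L : ℝ) ^ 2 = (16 * A) * (L : ℝ) ^ 2 / 16 := by ring
      _ ≤ (σ ^ 2 * (L : ℝ) ^ 2) * (L : ℝ) ^ 2 / 16 := by gcongr
      _ = (σ * (L : ℝ) ^ 2 / 2) ^ 2 / 4 := by ring
      _ ≤ Real.exp (σ * (L : ℝ) ^ 2 / 2) := hexp
  refine ⟨L₀, fun k a L _ hL hL₀L hak => ?_⟩
  obtain ⟨hAL, h2L⟩ := hL₀ L hL₀L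
  have hLe : Even L := ⟨2 ^ k, by rw [hL, pow_succ]; ring⟩
  have hLpos : (0 : ℝ) < L := by exact_mod_cast (show 0 < L by omega)
  -- the twist ratio and `ε`
  set t : ℝ := 1 - twistedPartitionFunction (d := 4) r.ρ β L z ⟨(0, 1), Fin.zero_lt_one⟩ /
      twistedPartitionFunction (d := 4) r.ρ β L 1 ⟨(0, 1), Fin.zero_lt_one⟩ with ht_def
  have ht0 : 0 ≤ t := by
    have hr1 : twistedPartitionFunction (d := 4) r.ρ β L z ⟨(0, 1), Fin.zero_lt_one⟩ /
        twistedPartitionFunction (d := 4) r.ρ β L 1 ⟨(0, 1), Fin.zero_lt_one⟩ ≤ 1 :=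
      (div_le_one (twistedPartitionFunction_pos r.ρ r.continuous β 1 _)).2
        (twistedPartitionFunction_le_untwisted_plane r.ρ β hLe r.continuous hz _)
    rw [ht_def]; linarith
  have htb : t ≤ max C' 0 * (L : ℝ) ^ 2 * Real.exp (-(σ * (L : ℝ) ^ 2)) := by
    refine (hbound L h2L).trans ?_
    gcongr
    exact le_max_left _ _
  set ε : ℝ := 8 * t / ‖1 - ω‖ ^ 2 with hε_def
  have hε0 : 0 ≤ ε := div_nonneg (by linarith) hω2.le
  -- `ε ≤ A L² e^{-σL²} ≤ e^{-σL²/2}`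
  have hε1 : ε ≤ Real.exp (-(σ * (L : ℝ) ^ 2 / 2)) := by
    have h1 : ε ≤ A * (L : ℝ) ^ 2 * Real.exp (-(σ * (L : ℝ) ^ 2)) := by
      have h8 : 8 * t / ‖1 - ω‖ ^ 2 ≤ 8 * (max C' 0 * (L : ℝ) ^ 2 * Real.exp (-(σ * (L : ℝ) ^ 2))) / ‖1 - ω‖ ^ 2 :=
        div_le_div_of_nonneg_right (by linarith) hω2.le
      rw [hε_def]
      refine h8.trans (le_of_eq ?_)
      rw [hA_def]
      ring
    refine h1.trans ?_
    calc A * (L : ℝ) ^ 2 * Real.exp (-(σ * (L : ℝ) ^ 2))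
        ≤ Real.exp (σ * (L : ℝ) ^ 2 / 2) * Real.exp (-(σ * (L : ℝ) ^ 2)) :=
          mul_le_mul_of_nonneg_right hAL (Real.exp_nonneg _)
      _ = Real.exp (-(σ * (L : ℝ) ^ 2 / 2)) := by rw [← Real.exp_add]; congr 1; ring
  -- Tomboulis–Yaffe, loop in the fundamental representation
  have hTY := wilsonLoopRep_abs_le_twist (d := 4) (L := L) r.ρ (fundamentalRep (Fin N)) k hL r.continuous
    (Literature.MathematicalPhysics.QuantumLattice.continuous_fundamentalRep (Fin N)) β (show (0 : Fin 4) < 1 by decide) hz hω hω1 hne a a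
    hak hak
  rw [← ht_def, ← hε_def] at hTY
  refine hTY.trans ?_
  have hN1 : (1 : ℝ) ≤ N := by exact_mod_cast (show 1 ≤ N by omega)
  have hN0 : (0 : ℝ) ≤ N := by positivity
  -- first factor: `N^{2h/L} ≤ N`
  have hexp1 : (((2 * 2 ^ a : ℕ) : ℝ) / L) ≤ 1 := by
    rw [div_le_one hLpos]
    have : 2 * 2 ^ a ≤ L := by
      rw [hL, pow_succ']
      exact Nat.mul_le_mul_left 2 (Nat.pow_le_pow_right two_pos hak)
    exact_mod_cast this
  have hfac1 : (N : ℝ) ^ (((2 * 2 ^ a : ℕ) : ℝ) / L) ≤ N := by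
    calc (N : ℝ) ^ (((2 * 2 ^ a : ℕ) : ℝ) / L) ≤ (N : ℝ) ^ (1 : ℝ) :=
          Real.rpow_le_rpow_of_exponent_le hN1 hexp1
      _ = N := Real.rpow_one _
  -- second factor: `ε^{h²/L²} ≤ e^{-σh²/2}`
  have hq0 : 0 ≤ (((2 ^ a * 2 ^ a : ℕ) : ℝ) / (L : ℝ) ^ 2) := by positivity
  have hfac2 : ε ^ (((2 ^ a * 2 ^ a : ℕ) : ℝ) / (L : ℝ) ^ 2) ≤ Real.exp (-(σ * ((2 ^ a : ℕ) : ℝ) ^ 2 / 2)) := by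
    calc ε ^ (((2 ^ a * 2 ^ a : ℕ) : ℝ) / (L : ℝ) ^ 2)
        ≤ Real.exp (-(σ * (L : ℝ) ^ 2 / 2)) ^ (((2 ^ a * 2 ^ a : ℕ) : ℝ) / (L : ℝ) ^ 2) :=
          Real.rpow_le_rpow hε0 hε1 hq0
      _ = Real.exp (-(σ * ((2 ^ a : ℕ) : ℝ) ^ 2 / 2)) := by
          rw [← Real.exp_mul]
          congr 1
          push_cast
          field_simp
  calc (N : ℝ) ^ (((2 * 2 ^ a : ℕ) : ℝ) / L) * ε ^ (((2 ^ a * 2 ^ a : ℕ) : ℝ) / (L : ℝ) ^ 2)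
      ≤ (N : ℝ) * Real.exp (-(σ * ((2 ^ a : ℕ) : ℝ) ^ 2 / 2)) :=
        mul_le_mul hfac1 hfac2 (Real.rpow_nonneg hε0 _) hN0

end SUN

/-! ## §4 The item -/

/-- **`FluxSectorAlternative.VortexAreaLawDeniesPerimeter` holds** (item ⟨stmt-QuantumFields-23871⟩, support of the routes
`FluxSectorAlternative` and `VortexVolumeRatchet`): an area-rate light centre flux for every non-trivial centre element and every
plane forces SOME infinite-volume limit point of the torus Wilson states of `r` (namely any limit along the dyadic sides `2^{k+1}`)
to violate the fundamental perimeter law — Tomboulis–Yaffe in two representations (the tree's `wilsonLoopRep_abs_le_twist`)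
bounds the fundamental `h × h` loop on the dyadic tori by `N e^{−σh²/2}`, the bound passes to the limit state, and
`e^{−4ch} ≤ N e^{−σh²/2}` fails for `h = 2^a` large. -/
theorem vortexAreaLawDeniesPerimeter_proof :
    Summit.QuantumFields.YangMills.Theses.FluxSectorAlternative.VortexAreaLawDeniesPerimeter := by
  intro N hN r β _hβ hflux hall
  haveI : NeZero N := ⟨by omega⟩
  -- the area-rate hypothesis at the centre element `ω·1` and the plane `(0,1)`
  obtain ⟨σ, C', hσ, hbound⟩ := hflux (suCenter N 1 : Matrix.specialUnitaryGroup (Fin N) ℂ) (suCenter N 1).2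
    (Literature.MathematicalPhysics.QuantumLattice.suCenter_ne_one_of_isUnit N hN isUnit_one) ⟨(0, 1), Fin.zero_lt_one⟩
  obtain ⟨L₀, hL₀⟩ := abs_wilsonLoop_le_of_areaRate hN r β hσ hbound
  -- a limit state along the dyadic sides `Ls k + 1 = 2^{k+1}`
  set Ls : ℕ → ℕ := fun k => 2 ^ (k + 1) - 1 with hLs_def
  have hLs1 : ∀ k, Ls k + 1 = 2 ^ (k + 1) := fun k => by
    rw [hLs_def]; exact Nat.sub_add_cancel Nat.one_le_two_pow
  have hLs : StrictMono Ls := by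
    refine strictMono_nat_of_lt_succ fun k => ?_
    have h1 : Ls k + 1 < Ls (k + 1) + 1 := by
      rw [hLs1, hLs1, pow_succ]; have := Nat.one_le_two_pow (n := k + 1); omega
    omega
  obtain ⟨μ, φ, hφ, hμ⟩ := exists_isInfiniteVolumeLimitAlong_comp (d := 4) r.ρ r.continuous β Ls
  have hmem : μ ∈ infiniteVolumeLimitPoints (d := 4) r.ρ β := ⟨Ls ∘ φ, hLs.comp hφ, hμ⟩
  obtain ⟨c, hc⟩ := hall μ hmem
  -- choose the loop size `h = 2^a` with `σ h²/2 > 4|c| h + log N`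
  obtain ⟨a, ha⟩ : ∃ a : ℕ, (8 * |c| + 2 * Real.log N + 2) / σ ≤ ((2 ^ a : ℕ) : ℝ) := by
    obtain ⟨a, ha⟩ := exists_nat_ge ((8 * |c| + 2 * Real.log N + 2) / σ)
    refine ⟨a, ha.trans ?_⟩
    exact_mod_cast (Nat.lt_two_pow_self).le
  set h : ℕ := 2 ^ a with hh_def
  have hh1 : 1 ≤ h := Nat.one_le_two_pow
  have hhR : (1 : ℝ) ≤ (h : ℝ) := by exact_mod_cast hh1
  have hlogN : 0 ≤ Real.log N := Real.log_nonneg (by exact_mod_cast (show 1 ≤ N by omega))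
  -- the torus bound holds eventually along `Ls ∘ φ`
  have hev : ∀ᶠ k : ℕ in atTop,
      |wilsonExpectation (L := (Ls ∘ φ) k + 1) r.ρ β
          (wilsonLoop (fundamentalRep (Fin N)) (0 : Site 4 ((Ls ∘ φ) k + 1)) 0 1 h h)| ≤
        (N : ℝ) * Real.exp (-(σ * (h : ℝ) ^ 2 / 2)) := by
    filter_upwards [eventually_ge_atTop (max L₀ a)] with k hk
    have hk1 : L₀ ≤ k := le_of_max_le_left hk
    have hk2 : a ≤ k := le_of_max_le_right hk
    have hφk : k ≤ φ k := hφ.id_le k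
    have hLk : (Ls ∘ φ) k + 1 = 2 ^ (φ k + 1) := hLs1 (φ k)
    have hL₀k : L₀ ≤ (Ls ∘ φ) k + 1 := by
      rw [hLk]
      calc L₀ ≤ k := hk1
        _ ≤ φ k + 1 := by omega
        _ ≤ 2 ^ (φ k + 1) := (Nat.lt_two_pow_self).le
    exact hL₀ (φ k) a ((Ls ∘ φ) k + 1) hLk hL₀k (hk2.trans hφk)
  have hlim := tendsto_wilsonExpectation_wilsonLoopRep (d := 4) r.ρ (fundamentalRep (Fin N))
    (Literature.MathematicalPhysics.QuantumLattice.continuous_fundamentalRep (Fin N)) hμ h h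
  have hup : rectExpectation μ (fun g => normalisedCharacter N (fundamentalRep (Fin N) g)) 0 1 h h ≤
      (N : ℝ) * Real.exp (-(σ * (h : ℝ) ^ 2 / 2)) :=
    le_of_tendsto hlim (hev.mono fun k hk => (le_abs_self _).trans hk)
  have hlow := hc h h hh1 hh1
  -- `e^{-4 c h} ≤ N e^{-σ h²/2}` is absurd
  have hNpos : (0 : ℝ) < N := by exact_mod_cast (show 0 < N by omega)
  have key : Real.exp (-c * (2 * ((h : ℝ) + h))) ≤ Real.exp (Real.log N + -(σ * (h : ℝ) ^ 2 / 2)) := by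
    rw [Real.exp_add, Real.exp_log hNpos]
    exact hlow.trans hup
  have key' := Real.exp_le_exp.1 key
  have hσh : (8 * |c| + 2 * Real.log N + 2) ≤ σ * (h : ℝ) := by
    have := ha; rw [div_le_iff₀ hσ] at this; linarith
  have hh0 : (0 : ℝ) ≤ (h : ℝ) := by positivity
  have h1 : (4 * |c| + Real.log N + 1) * h ≤ σ * (h : ℝ) ^ 2 / 2 := by nlinarith [hσh, hh0]
  have h2 : -(4 * |c| * (h : ℝ)) ≤ -c * (2 * ((h : ℝ) + h)) := by nlinarith [le_abs_self c, neg_abs_le c, hh0]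
  have h3 : Real.log N ≤ Real.log N * h := by nlinarith [hlogN, hhR]
  nlinarith [h1, h2, h3, hlogN, key', abs_nonneg c]

end Summit.QuantumFields.YangMills.Theorems.FluxSectorAlternative

end
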